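import Summits.BirchSwinnertonDyer.BirchSwinnertonDyer.Theorems.ClassRecordThreeEulerHalvesAtThreeCartanTorusCubeCut
import Summits.BirchSwinnertonDyer.BirchSwinnertonDyer.Theorems.ClassRecordThreeEulerHalvesAtThreeCartanTorusCubeCutCentre

/-!
# `Lines/cartan_sk1.lean` r2 — the TORUS-CUBE CUT of S-K1′ = stub (F2a) `stub_cubicTorusPeriodRatioAtThreeGeFive` of 23422 `Lines/cartan.lean` v8′ (e7969df5de15) = v9 (89939c04607c33af, plan g44 00:41:48Z; the (F2a) stub is unchanged),
# target decl `Summit.BirchSwinnertonDyer.BirchSwinnertonDyer.Theorems.CartanDegree.CubicTorusPeriodRatioAtThreeGeFive`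

bsd-idea-10 g11 (planner-bsd-idea-10-g11-0, D-0145 ideator), 2026-08-29. UNREGISTERED SUB-LINE (W-79 ∕ RULING 91(a): one level below stub (F2a) of the keyed 23422
skeleton `Lines/cartan.lean` v8′/v9; no `skeleton check`; the `P_*` are NOT stubs of any registered skeleton, RULING 91(b)). NO SUMMIT STATEMENT IS PROVED.

r2 = THIN WRAPPER over landed Theorems files (r1 = commit bc8966080569 carried the same mathematics inline, with six inputs):
* `Theorems/ClassRecordThreeEulerHalvesAtThreeCartanTorusCubeCutFrame.lean` (bsd-idea-10 g11, p680737 ✓): norm operators `N_S` of `T_s`, `T_C`, `T_C³` on a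
  `CartanTorusLattice q`, torus-fixedness, the PAIRING LEMMA `A·B(w_S,w_S)·|T| = b·B(w_C,w_C)·|T_s|`, the RANK-ONE TRACE IDENTITY
  `Σ χ_W(s g t g⁻¹) = tr(N_S ρ(g) N_T ρ(g)⁻¹) = A·b`, 3-adic bookkeeping — proved;
* `…CartanTorusCubeCutTori.lean` (bsd-idea-10 g11, p681375 ✓): (T) clauses 1–2 `splitTorus_card : |T_s| = (q−1)²`, `nonsplitTorus_card : |T_C| = (q−1)(q+1)` — proved;
* `…CartanTorusCubeCutCyclic.lean` (tam3-p1 g21, p682001 ✓): `T_C` cyclic, (T) clause 3 `nonsplitCubes_card : 3·|T_C³| = (q−1)(q+1)` — proved; so input (T) is GONE;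
* `…CartanTorusCubeCutCentre.lean` (bsd-idea-10 g11, p682009 ✓): LEMMA Z `rho_eq_one_of_isScalarMat` (the centre acts trivially) — proved (input of (P1), (P3));
* `…CartanTorusCubeCut.lean` (bsd-idea-10 g11, p683297 ✓): the five `@[conjecture]`-tagged inputs `P_cuspCubeNormFixed` (C1), `P_cuspGoodConjugate` (C2),
  `P_psNonsplitNormLower` (P1), `P_psSplitNormSharp` (P2), `P_psNonsplitNormSharp` (P3), the proved cases `cusp_case` (q ≡ 2 (3)) and `ps_case` (q ≡ 1 (3)), and the
  proved conditional composition `cubicTorusPeriodRatioAtThreeGeFive_of : P_cuspCubeNormFixed → … → P_psNonsplitNormSharp → CubicTorusPeriodRatioAtThreeGeFive` (BY NAME).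
This file: the five inputs as `sorry`-stubs (the ONLY sorries) and `cubicTorusPeriodRatioAtThreeGeFive_closed : CubicTorusPeriodRatioAtThreeGeFive` from them, BY NAME.
CLOSE PATH (RULING 91(b); division of labour on the cell bus 2026-08-29T00:19:32Z ∕ 00:27:51Z: tam3-p1 lineage (C1), (C2); cartan-f2a lineage (P1)–(P3)): prove each
`P_*` as a Theorems helper (`--supports stmt-BirchSwinnertonDyer-23422` or `…-19109 --as helper`), then the registered
`stub_cubicTorusPeriodRatioAtThreeGeFive := cubicTorusPeriodRatioAtThreeGeFive_of ‹C1› ‹C2› ‹P1› ‹P2› ‹P3›`. Proof sketches, sizes, numerics (q = 5 … 37): `Lines/cartan_sk1.md`.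
-/

set_option linter.dupNamespace false

namespace Summit.BirchSwinnertonDyer.BirchSwinnertonDyer.Cruxes.EulerHalvesAtThree.CartanSK1

open Summit.BirchSwinnertonDyer.BirchSwinnertonDyer.Theorems.CartanDegree
open Summit.BirchSwinnertonDyer.BirchSwinnertonDyer.Theorems.CartanTorusCubeCut

/-- (C1) stub, cusp `q ≡ 2 (3)`: cube norms `N_{T_C³} x` are `T_C`-fixed (`Σ_{t∈T_C³} χ_W(t) = |T_C³|`; ℚ-idempotent `3·N_{T_C³} = N_{T_C}` via
`matrix_eq_one_of_pow_eq_one_of_trace`-style trace argument). Size M. -/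
theorem stub_cuspCubeNormFixed : P_cuspCubeNormFixed := by
  sorry

/-- (C2) stub, cusp `q ≡ 2 (3)`: `∃ g, 3 ∤ S₃(g)` (orbit count on `P¹(𝔽_q)`; decidable per `q`). Size M. -/
theorem stub_cuspGoodConjugate : P_cuspGoodConjugate := by
  sorry

/-- (P1) stub, PS `q ≡ 1 (3)`: `N_{T_C}(ρ(g) w_S) = m·w_C ⇒ 3^{ord₃(q−1)+1} ∣ m` (Lemma Z `rho_eq_one_of_isScalarMat` — proved — + `St̄` simple +
`λ : X/3X ↠ 𝟙`). Size M/L. -/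
theorem stub_psNonsplitNormLower : P_psNonsplitNormLower := by
  sorry

/-- (P2) stub, PS `q ≡ 1 (3)`: `∃ g`, `N_{T_s}(ρ(g) w_C) = m·w_S ⇒ 3^{ord₃(q−1)+1} ∤ m` (`U`-isotypic freeness over `ℤ₃[ζ_q]`). Size M. -/
theorem stub_psSplitNormSharp : P_psSplitNormSharp := by
  sorry

/-- (P3) stub, PS `q ≡ 1 (3)`: `∃ g`, `N_{T_C}(ρ(g)⁻¹ w_S) = m·w_C ⇒ 3^{ord₃(q−1)+2} ∤ m`, and `3^{ord₃(q−1)} ∣` the split norm coefficient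
(non-splitness of `X_M/3X_M`; Lemma Z — proved). HARDEST (q ≡ 1 (9)). Size L. -/
theorem stub_psNonsplitNormSharp : P_psNonsplitNormSharp := by
  sorry

/-- (F2a) `CubicTorusPeriodRatioAtThreeGeFive`, closed modulo the five stubs above, BY NAME, through the landed conditional theorem. -/
theorem cubicTorusPeriodRatioAtThreeGeFive_closed : CubicTorusPeriodRatioAtThreeGeFive :=
  cubicTorusPeriodRatioAtThreeGeFive_of stub_cuspCubeNormFixed stub_cuspGoodConjugate
    stub_psNonsplitNormLower stub_psSplitNormSharp stub_psNonsplitNormSharp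

end Summit.BirchSwinnertonDyer.BirchSwinnertonDyer.Cruxes.EulerHalvesAtThree.CartanSK1
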